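import Literature.Analysis.SpecialFunctions.LegendrePolynomialsBonnet
import Mathlib.Analysis.SpecialFunctions.Integrals.Basic
import Mathlib.Analysis.SpecialFunctions.Sqrt
import HarnessLib

/-!
# Legendre groundwork for the far-field iterate certificate: `P₂`, `P₃`, `μ₂`, `μ₃`, the `L¹` norms,
# the one-step distance `∫|x₊² - 1/8 - x/4| = 1/4`, and the tail bounds `‖P_ℓ‖₁ ≤ 2/√(2ℓ+1)`,
# `μ_ℓ ≤ 4/√(5(2ℓ+1))` (helpers `t12_legendre_mu_two`, `t12_posPartSq_affineL1` of the line `birth`,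
# crux `TwoClocks.EquilibriumFastWindowLD`, stmt-AtomisticToContinuum-14440; infrastructure file 3
# of the analytic residue `t12_logLinearPreimage_and_dipoleModulus` of `stub_correctorTransfer`)

Plan §6 of the registered sub-goal `t12_logLinearPreimage_and_dipoleModulus` bounds the `k`-fold
far-field gain iterate on the `ℓ ≥ 2` functions of `L^∞(S²)` by the Legendre series
`μ^{(k)} ≤ Σ_{ℓ ≥ 2} c_ℓ μ_ℓ^k`, `c_ℓ = (2ℓ+1)/2 · ‖P_ℓ‖_{L¹[-1,1]}`, `μ_ℓ = 4 ∫₀¹ ρ² |P_ℓ(ρ)| dρ`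
(the circle average `A_ρ` acts on the degree-`ℓ` harmonics as `P_ℓ(ρ)`; the radius ratio `ρ` of
one far-field collision has law `4ρ² dρ`-moments, `t12_indicial_*`), and needs (`LegendreBound`)
certified head values `μ_ℓ, c_ℓ` for small `ℓ` plus an elementary tail. With the tree's Rodrigues
`Literature.Analysis.SpecialFunctions.legendre` (Bonnet recursion, `∫_{-1}^{1} P_n² = 2/(2n+1)`,
parity) this file proves, by splitting at the sign changes and the closed form `integral_poly6`:

* `eval_legendre_two/three` — `P₂ = (3x² - 1)/2`, `P₃ = (5x³ - 3x)/2`;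
* `t12_legendre_mu_two` (registered) — **`μ₂ = 8/15 + 8√3/135 ≈ 0.636`** (`= sup_ℓ μ_ℓ`), and
  `integral_abs_legendre_two` — `‖P₂‖₁ = 4√3/9`; `four_mul_integral_sq_mul_abs_legendre_three` —
  **`μ₃ = 79/150`**, `integral_abs_legendre_three` — `‖P₃‖₁ = 13/20` (rational: only even powers
  of the root `√(3/5)` enter);
* `t12_posPartSq_affineL1` (registered) — **`∫_{-1}^{1} |x₊² - 1/8 - x/4| dx = 1/4`**, the
  `L¹`-distance of the one-step kernel `x₊²` to `span{1, x}` at the optimal affine profile; with the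
  angular contraction lemma `t12_angularContraction` (sibling file `…BirthT12Angular`) the one-step
  far-field operator `(2/π)(n·ω)₊²` has norm `(2/π) · 2π · 1/4 = 1` on the sector `ℓ ≥ 2` — exactly
  marginal, whence the iteration (`four_mul_posPartSq_affineL1`);
* LG2, the tail — `integral_legendre_sq_half` (`∫₀¹ P_n² = 1/(2n+1)`), `integral_abs_legendre_le`
  (**`‖P_n‖₁ ≤ 2/√(2n+1)`**) and `four_mul_integral_sq_mul_abs_legendre_le`
  (**`μ_n ≤ 4/√(5(2n+1))`**), both by the pointwise AM–GM form of Cauchy–Schwarz.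

NOT here: the lower bound of the `L¹`-distance, the head values `4 ≤ ℓ ≤ 20`, `Σ c_ℓ μ_ℓ^6 < 1`.
-/

noncomputable section

open MeasureTheory Real Set intervalIntegral Polynomial
namespace Summit.AtomisticToContinuum.HydrodynamicLimit.Theorems.ClampedCorrectorBirth
open Literature.Analysis.SpecialFunctions

/-! ### Polynomial integrals (the only calculus used below) -/

/-- `∫_a^b (p₆x⁶ + p₅x⁵ + p₄x⁴ + p₃x³ + p₂x² + p₁x + p₀) dx` in closed form (fundamental theorem
of calculus); every integral below is a sum of such pieces. [folklore] -/
theorem integral_poly6 (p₀ p₁ p₂ p₃ p₄ p₅ p₆ a b : ℝ) :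
    ∫ x in a..b, (p₆ * x ^ 6 + p₅ * x ^ 5 + p₄ * x ^ 4 + p₃ * x ^ 3 + p₂ * x ^ 2 + p₁ * x + p₀) =
      (p₆ / 7 * b ^ 7 + p₅ / 6 * b ^ 6 + p₄ / 5 * b ^ 5 + p₃ / 4 * b ^ 4 + p₂ / 3 * b ^ 3 +
          p₁ / 2 * b ^ 2 + p₀ * b) -
        (p₆ / 7 * a ^ 7 + p₅ / 6 * a ^ 6 + p₄ / 5 * a ^ 5 + p₃ / 4 * a ^ 4 + p₂ / 3 * a ^ 3 +
          p₁ / 2 * a ^ 2 + p₀ * a) := by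
  rw [integral_eq_sub_of_hasDerivAt (f := fun y : ℝ => p₆ / 7 * y ^ 7 + p₅ / 6 * y ^ 6 +
    p₄ / 5 * y ^ 5 + p₃ / 4 * y ^ 4 + p₂ / 3 * y ^ 3 + p₁ / 2 * y ^ 2 + p₀ * y)]
  · intro x _
    have h7 : HasDerivAt (fun y : ℝ => y ^ 7) (7 * x ^ 6) x := by simpa using hasDerivAt_pow 7 x
    have h6 : HasDerivAt (fun y : ℝ => y ^ 6) (6 * x ^ 5) x := by simpa using hasDerivAt_pow 6 x
    have h5 : HasDerivAt (fun y : ℝ => y ^ 5) (5 * x ^ 4) x := by simpa using hasDerivAt_pow 5 x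
    have h4 : HasDerivAt (fun y : ℝ => y ^ 4) (4 * x ^ 3) x := by simpa using hasDerivAt_pow 4 x
    have h3 : HasDerivAt (fun y : ℝ => y ^ 3) (3 * x ^ 2) x := by simpa using hasDerivAt_pow 3 x
    have h2 : HasDerivAt (fun y : ℝ => y ^ 2) (2 * x) x := by simpa using hasDerivAt_pow 2 x
    refine (((((((h7.const_mul (p₆ / 7)).add (h6.const_mul (p₅ / 6))).add
      (h5.const_mul (p₄ / 5))).add (h4.const_mul (p₃ / 4))).add (h3.const_mul (p₂ / 3))).add
      (h2.const_mul (p₁ / 2))).add ((hasDerivAt_id x).const_mul p₀)).congr_deriv ?_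
    ring
  · exact (by fun_prop : Continuous fun x : ℝ => p₆ * x ^ 6 + p₅ * x ^ 5 + p₄ * x ^ 4 +
      p₃ * x ^ 3 + p₂ * x ^ 2 + p₁ * x + p₀).intervalIntegrable a b

/-- Even integrands: `∫_{-1}^{1} g = 2 ∫₀¹ g`. [folklore] -/
theorem integral_symm_interval_of_even {g : ℝ → ℝ} (hg : ∀ x, g (-x) = g x)
    (hI : ∀ a b : ℝ, IntervalIntegrable g volume a b) :
    ∫ x in (-1 : ℝ)..1, g x = 2 * ∫ x in (0 : ℝ)..1, g x := by
  have h := intervalIntegral.integral_comp_neg (a := (0 : ℝ)) (b := 1) (f := g)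
  simp only [hg, neg_zero] at h
  rw [← integral_add_adjacent_intervals (b := 0) (hI _ _) (hI _ _), ← h]
  ring

/-! ### `P₂`, `P₃` explicitly -/

/-- `P₂ = (3X² - 1)/2` for the tree's (Rodrigues) Legendre polynomial `legendre 2`. [folklore] -/
theorem eval_legendre_two (x : ℝ) : (legendre 2).eval x = (3 * x ^ 2 - 1) / 2 := by
  have h : legendre 2 = C ((2 * ((0 : ℕ) : ℝ) + 3) / ((0 : ℕ) + 2)) * X * legendre 1 -
      C ((((0 : ℕ) : ℝ) + 1) / ((0 : ℕ) + 2)) * legendre 0 := legendre_add_two 0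
  rw [h]
  simp only [eval_sub, eval_mul, eval_C, eval_X, legendre_one, legendre_zero, eval_one,
    Nat.cast_zero]
  ring

/-- `P₃ = (5X³ - 3X)/2` for the tree's (Rodrigues) Legendre polynomial `legendre 3`. [folklore] -/
theorem eval_legendre_three (x : ℝ) : (legendre 3).eval x = (5 * x ^ 3 - 3 * x) / 2 := by
  have h : legendre 3 = C ((2 * ((1 : ℕ) : ℝ) + 3) / ((1 : ℕ) + 2)) * X * legendre 2 -
      C ((((1 : ℕ) : ℝ) + 1) / ((1 : ℕ) + 2)) * legendre 1 := legendre_add_two 1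
  rw [h]
  simp only [eval_sub, eval_mul, eval_C, eval_X, legendre_one, eval_legendre_two, Nat.cast_one]
  ring

/-! ### The constants of `P₂` -/

/-- **`μ₂ = 4 ∫₀¹ ρ² |P₂(ρ)| dρ = 8/15 + 8√3/135 ≈ 0.6360`** — the `ℓ = 2` value of the crude
one-step constants `μ_ℓ := 4 ∫₀¹ ρ² |P_ℓ(ρ)| dρ` of the far-field iterate bound (plan §6: the
`k`-fold product `Π_i |P_ℓ(ρ_i)|` averaged against the radial law `4ρ² dρ`… of each step; `μ₂`
is the largest, `sup_{ℓ ≥ 2} μ_ℓ = μ₂`). `P₂` changes sign at `ρ = 1/√3`. Registered helper. -/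
theorem t12_legendre_mu_two : 4 * ∫ ρ in (0 : ℝ)..1, ρ ^ 2 * |(Literature.Analysis.SpecialFunctions.legendre 2).eval ρ| = 8 / 15 + 8 * Real.sqrt 3 / 135 := by
  set c : ℝ := Real.sqrt 3 / 3 with hc
  have hc2 : c ^ 2 = 1 / 3 := by rw [hc, div_pow, Real.sq_sqrt (by norm_num)]; norm_num
  have hc0 : 0 < c := by positivity
  have hc1 : c ≤ 1 := by nlinarith
  have hc3 : c ^ 3 = c / 3 := by rw [pow_succ, hc2]; ring
  have hc5 : c ^ 5 = c / 9 := by rw [show c ^ 5 = (c ^ 2) ^ 2 * c by ring, hc2]; ring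
  have hcont : Continuous fun ρ : ℝ => ρ ^ 2 * |(3 * ρ ^ 2 - 1) / 2| := by fun_prop
  simp_rw [eval_legendre_two]
  rw [← integral_add_adjacent_intervals (b := c) (hcont.intervalIntegrable _ _)
    (hcont.intervalIntegrable _ _)]
  -- on `[0, c]`: `P₂ ≤ 0`
  have p1 : ∫ ρ in (0 : ℝ)..c, ρ ^ 2 * |(3 * ρ ^ 2 - 1) / 2| =
      ∫ ρ in (0 : ℝ)..c,
        (0 * ρ ^ 6 + 0 * ρ ^ 5 + -(3 / 2) * ρ ^ 4 + 0 * ρ ^ 3 + 1 / 2 * ρ ^ 2 + 0 * ρ + 0) := by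
    refine integral_congr fun ρ hρ => ?_
    rw [uIcc_of_le hc0.le] at hρ
    have h : 3 * ρ ^ 2 - 1 ≤ 0 := by nlinarith [pow_le_pow_left₀ hρ.1 hρ.2 2]
    rw [abs_of_nonpos (by linarith)]
    ring
  -- on `[c, 1]`: `P₂ ≥ 0`
  have p2 : ∫ ρ in c..1, ρ ^ 2 * |(3 * ρ ^ 2 - 1) / 2| =
      ∫ ρ in c..1,
        (0 * ρ ^ 6 + 0 * ρ ^ 5 + 3 / 2 * ρ ^ 4 + 0 * ρ ^ 3 + -(1 / 2) * ρ ^ 2 + 0 * ρ + 0) := by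
    refine integral_congr fun ρ hρ => ?_
    rw [uIcc_of_le hc1] at hρ
    have h : 0 ≤ 3 * ρ ^ 2 - 1 := by nlinarith [pow_le_pow_left₀ hc0.le hρ.1 2]
    rw [abs_of_nonneg (by linarith)]
    ring
  rw [p1, p2, integral_poly6, integral_poly6, hc5, hc3, hc]
  ring

/-- **`‖P₂‖_{L¹[-1,1]} = ∫_{-1}^{1} |P₂| = 4√3/9 ≈ 0.7698`** (the weight `c_2 = (5/2)‖P₂‖₁` of the
Legendre-series bound of plan §6; `|P₂|` is even, split `[0, 1]` at `1/√3`). [folklore] -/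
theorem integral_abs_legendre_two :
    ∫ x in (-1 : ℝ)..1, |(legendre 2).eval x| = 4 * Real.sqrt 3 / 9 := by
  set c : ℝ := Real.sqrt 3 / 3 with hc
  have hc2 : c ^ 2 = 1 / 3 := by rw [hc, div_pow, Real.sq_sqrt (by norm_num)]; norm_num
  have hc0 : 0 < c := by positivity
  have hc1 : c ≤ 1 := by nlinarith
  have hc3 : c ^ 3 = c / 3 := by rw [pow_succ, hc2]; ring
  have hcont : Continuous fun x : ℝ => |(3 * x ^ 2 - 1) / 2| := by fun_prop
  simp_rw [eval_legendre_two]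
  rw [integral_symm_interval_of_even (fun x => by ring_nf)
      (fun a b => hcont.intervalIntegrable a b),
    ← integral_add_adjacent_intervals (b := c) (hcont.intervalIntegrable _ _)
      (hcont.intervalIntegrable _ _)]
  have p1 : ∫ x in (0 : ℝ)..c, |(3 * x ^ 2 - 1) / 2| =
      ∫ x in (0 : ℝ)..c, (0 * x ^ 6 + 0 * x ^ 5 + 0 * x ^ 4 + 0 * x ^ 3 + -(3 / 2) * x ^ 2 +
        0 * x + 1 / 2) := by
    refine integral_congr fun x hx => ?_
    rw [uIcc_of_le hc0.le] at hx
    have h : 3 * x ^ 2 - 1 ≤ 0 := by nlinarith [pow_le_pow_left₀ hx.1 hx.2 2]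
    rw [abs_of_nonpos (by linarith)]
    ring
  have p2 : ∫ x in c..1, |(3 * x ^ 2 - 1) / 2| =
      ∫ x in c..1, (0 * x ^ 6 + 0 * x ^ 5 + 0 * x ^ 4 + 0 * x ^ 3 + 3 / 2 * x ^ 2 +
        0 * x + -(1 / 2)) := by
    refine integral_congr fun x hx => ?_
    rw [uIcc_of_le hc1] at hx
    have h : 0 ≤ 3 * x ^ 2 - 1 := by nlinarith [pow_le_pow_left₀ hc0.le hx.1 2]
    rw [abs_of_nonneg (by linarith)]
    ring
  rw [p1, p2, integral_poly6, integral_poly6, hc3, hc]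
  ring

/-! ### The constants of `P₃` (all rational: only even powers of the root `√(3/5)` enter) -/

/-- **`μ₃ = 4 ∫₀¹ ρ² |P₃(ρ)| dρ = 79/150 ≈ 0.5267`** (`P₃ = (5ρ³ - 3ρ)/2` changes sign at
`ρ = √(3/5)`; the value is rational). [folklore] -/
theorem four_mul_integral_sq_mul_abs_legendre_three :
    4 * ∫ ρ in (0 : ℝ)..1, ρ ^ 2 * |(legendre 3).eval ρ| = 79 / 150 := by
  set c : ℝ := Real.sqrt 15 / 5 with hc
  have hc2 : c ^ 2 = 3 / 5 := by rw [hc, div_pow, Real.sq_sqrt (by norm_num)]; norm_num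
  have hc0 : 0 < c := by positivity
  have hc1 : c ≤ 1 := by nlinarith
  have hc4 : c ^ 4 = 9 / 25 := by rw [show c ^ 4 = (c ^ 2) ^ 2 by ring, hc2]; norm_num
  have hc6 : c ^ 6 = 27 / 125 := by rw [show c ^ 6 = (c ^ 2) ^ 3 by ring, hc2]; norm_num
  have hcont : Continuous fun ρ : ℝ => ρ ^ 2 * |(5 * ρ ^ 3 - 3 * ρ) / 2| := by fun_prop
  simp_rw [eval_legendre_three]
  rw [← integral_add_adjacent_intervals (b := c) (hcont.intervalIntegrable _ _)
    (hcont.intervalIntegrable _ _)]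
  have p1 : ∫ ρ in (0 : ℝ)..c, ρ ^ 2 * |(5 * ρ ^ 3 - 3 * ρ) / 2| =
      ∫ ρ in (0 : ℝ)..c, (0 * ρ ^ 6 + -(5 / 2) * ρ ^ 5 + 0 * ρ ^ 4 + 3 / 2 * ρ ^ 3 + 0 * ρ ^ 2 +
        0 * ρ + 0) := by
    refine integral_congr fun ρ hρ => ?_
    rw [uIcc_of_le hc0.le] at hρ
    have h : 5 * ρ ^ 2 - 3 ≤ 0 := by nlinarith [pow_le_pow_left₀ hρ.1 hρ.2 2]
    rw [abs_of_nonpos (by nlinarith [mul_nonpos_iff.2 (Or.inl ⟨hρ.1, h⟩)])]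
    ring
  have p2 : ∫ ρ in c..1, ρ ^ 2 * |(5 * ρ ^ 3 - 3 * ρ) / 2| =
      ∫ ρ in c..1, (0 * ρ ^ 6 + 5 / 2 * ρ ^ 5 + 0 * ρ ^ 4 + -(3 / 2) * ρ ^ 3 + 0 * ρ ^ 2 +
        0 * ρ + 0) := by
    refine integral_congr fun ρ hρ => ?_
    rw [uIcc_of_le hc1] at hρ
    have h : 0 ≤ 5 * ρ ^ 2 - 3 := by nlinarith [pow_le_pow_left₀ hc0.le hρ.1 2]
    rw [abs_of_nonneg (by nlinarith [mul_nonneg (hc0.le.trans hρ.1) h])]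
    ring
  rw [p1, p2, integral_poly6, integral_poly6, hc4, hc6]
  norm_num

/-- **`‖P₃‖_{L¹[-1,1]} = 13/20`** (`|P₃|` is even; split `[0, 1]` at `√(3/5)`). [folklore] -/
theorem integral_abs_legendre_three : ∫ x in (-1 : ℝ)..1, |(legendre 3).eval x| = 13 / 20 := by
  set c : ℝ := Real.sqrt 15 / 5 with hc
  have hc2 : c ^ 2 = 3 / 5 := by rw [hc, div_pow, Real.sq_sqrt (by norm_num)]; norm_num
  have hc0 : 0 < c := by positivity
  have hc1 : c ≤ 1 := by nlinarith
  have hc4 : c ^ 4 = 9 / 25 := by rw [show c ^ 4 = (c ^ 2) ^ 2 by ring, hc2]; norm_num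
  have hcont : Continuous fun x : ℝ => |(5 * x ^ 3 - 3 * x) / 2| := by fun_prop
  simp_rw [eval_legendre_three]
  rw [integral_symm_interval_of_even (fun x => by rw [← abs_neg]; ring_nf)
      (fun a b => hcont.intervalIntegrable a b),
    ← integral_add_adjacent_intervals (b := c) (hcont.intervalIntegrable _ _)
      (hcont.intervalIntegrable _ _)]
  have p1 : ∫ x in (0 : ℝ)..c, |(5 * x ^ 3 - 3 * x) / 2| =
      ∫ x in (0 : ℝ)..c, (0 * x ^ 6 + 0 * x ^ 5 + 0 * x ^ 4 + -(5 / 2) * x ^ 3 + 0 * x ^ 2 +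
        3 / 2 * x + 0) := by
    refine integral_congr fun x hx => ?_
    rw [uIcc_of_le hc0.le] at hx
    have h : 5 * x ^ 2 - 3 ≤ 0 := by nlinarith [pow_le_pow_left₀ hx.1 hx.2 2]
    rw [abs_of_nonpos (by nlinarith [mul_nonpos_iff.2 (Or.inl ⟨hx.1, h⟩)])]
    ring
  have p2 : ∫ x in c..1, |(5 * x ^ 3 - 3 * x) / 2| =
      ∫ x in c..1, (0 * x ^ 6 + 0 * x ^ 5 + 0 * x ^ 4 + 5 / 2 * x ^ 3 + 0 * x ^ 2 +
        -(3 / 2) * x + 0) := by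
    refine integral_congr fun x hx => ?_
    rw [uIcc_of_le hc1] at hx
    have h : 0 ≤ 5 * x ^ 2 - 3 := by nlinarith [pow_le_pow_left₀ hc0.le hx.1 2]
    rw [abs_of_nonneg (by nlinarith [mul_nonneg (hc0.le.trans hx.1) h])]
    ring
  rw [p1, p2, integral_poly6, integral_poly6, hc2, hc4]
  norm_num

/-! ### The `L¹` certificate of the one-step far-field constant -/

/-- **The FF3 distance certificate `∫_{-1}^{1} |x₊² - 1/8 - x/4| dx = 1/4`.** With the optimal
affine profile `a + bx = 1/8 + x/4` this is `dist_{L¹[-1,1]}(x₊², span{1, x})`, so the one-step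
far-field gain operator `(2/π)(n·ω)₊²` has norm `(2/π) · 2π · (1/4) = 1` EXACTLY on the `ℓ ≥ 2`
functions of `L^∞(S²)` (`t12_angularContraction`): one step does not contract, which is why plan §6
iterates. Split at the sign changes `-1/2` (of `-1/8 - x/4`) and `1/2` (of `x² - x/4 - 1/8` on
`[0, 1]`). Registered helper. -/
theorem t12_posPartSq_affineL1 : ∫ x in (-1 : ℝ)..1, |max x 0 ^ 2 - 1 / 8 - x / 4| = 1 / 4 := by
  have hcont : Continuous fun x : ℝ => |max x 0 ^ 2 - 1 / 8 - x / 4| := by fun_prop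
  have hI : ∀ a b : ℝ, IntervalIntegrable (fun x : ℝ => |max x 0 ^ 2 - 1 / 8 - x / 4|) volume a b :=
    fun a b => hcont.intervalIntegrable a b
  rw [← integral_add_adjacent_intervals (b := 0) (hI _ _) (hI _ _),
    ← integral_add_adjacent_intervals (a := -1) (b := -1 / 2) (c := 0) (hI _ _) (hI _ _),
    ← integral_add_adjacent_intervals (a := 0) (b := 1 / 2) (c := 1) (hI _ _) (hI _ _)]
  have p1 : ∫ x in (-1 : ℝ)..(-1 / 2), |max x 0 ^ 2 - 1 / 8 - x / 4| =
      ∫ x in (-1 : ℝ)..(-1 / 2),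
        (0 * x ^ 6 + 0 * x ^ 5 + 0 * x ^ 4 + 0 * x ^ 3 + 0 * x ^ 2 + -(1 / 4) * x + -(1 / 8)) := by
    refine integral_congr fun x hx => ?_
    rw [uIcc_of_le (by norm_num)] at hx
    rw [max_eq_right (by linarith [hx.2]), abs_of_nonneg (by linarith [hx.2])]
    ring
  have p2 : ∫ x in (-1 / 2 : ℝ)..0, |max x 0 ^ 2 - 1 / 8 - x / 4| =
      ∫ x in (-1 / 2 : ℝ)..0,
        (0 * x ^ 6 + 0 * x ^ 5 + 0 * x ^ 4 + 0 * x ^ 3 + 0 * x ^ 2 + 1 / 4 * x + 1 / 8) := by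
    refine integral_congr fun x hx => ?_
    rw [uIcc_of_le (by norm_num)] at hx
    rw [max_eq_right hx.2, abs_of_nonpos (by linarith [hx.1])]
    ring
  have p3 : ∫ x in (0 : ℝ)..(1 / 2), |max x 0 ^ 2 - 1 / 8 - x / 4| =
      ∫ x in (0 : ℝ)..(1 / 2),
        (0 * x ^ 6 + 0 * x ^ 5 + 0 * x ^ 4 + 0 * x ^ 3 + -1 * x ^ 2 + 1 / 4 * x + 1 / 8) := by
    refine integral_congr fun x hx => ?_
    rw [uIcc_of_le (by norm_num)] at hx
    rw [max_eq_left hx.1, abs_of_nonpos (by nlinarith [hx.1, hx.2])]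
    ring
  have p4 : ∫ x in (1 / 2 : ℝ)..1, |max x 0 ^ 2 - 1 / 8 - x / 4| =
      ∫ x in (1 / 2 : ℝ)..1,
        (0 * x ^ 6 + 0 * x ^ 5 + 0 * x ^ 4 + 0 * x ^ 3 + 1 * x ^ 2 + -(1 / 4) * x + -(1 / 8)) := by
    refine integral_congr fun x hx => ?_
    rw [uIcc_of_le (by norm_num)] at hx
    rw [max_eq_left (by linarith [hx.1]), abs_of_nonneg (by nlinarith [hx.1, hx.2])]
    ring
  rw [p1, p2, p3, p4, integral_poly6, integral_poly6, integral_poly6, integral_poly6]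
  norm_num

/-- The one-step far-field constant is exactly one: `4 · ∫_{-1}^{1} |x₊² - 1/8 - x/4| dx = 1`
(`= (2/π) · 2π · dist_{L¹}`; plan §6, "already marginal"). [folklore] -/
theorem four_mul_posPartSq_affineL1 :
    4 * ∫ x in (-1 : ℝ)..1, |max x 0 ^ 2 - 1 / 8 - x / 4| = 1 := by
  rw [t12_posPartSq_affineL1]; norm_num

/-! ### LG2: elementary tail bounds for all degrees -/

/-- The Legendre polynomials are interval integrable (continuity), in every power. [folklore] -/
theorem intervalIntegrable_legendre_pow (n k : ℕ) (a b : ℝ) :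
    IntervalIntegrable (fun x : ℝ => (legendre n).eval x ^ k) volume a b :=
  ((legendre n).continuous.pow k).intervalIntegrable a b

/-- **Half-range norm** `∫₀¹ P_n² = 1/(2n+1)` (parity `P_n(-x) = (-1)ⁿ P_n(x)` and
`∫_{-1}^{1} P_n² = 2/(2n+1)`). [folklore] -/
theorem integral_legendre_sq_half (n : ℕ) :
    ∫ x in (0 : ℝ)..1, (legendre n).eval x ^ 2 = 1 / (2 * n + 1) := by
  have heven : ∀ x : ℝ, (legendre n).eval (-x) ^ 2 = (legendre n).eval x ^ 2 := fun x => by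
    rw [eval_neg_legendre, mul_pow, ← pow_mul, mul_comm n 2, pow_mul, neg_one_sq, one_pow, one_mul]
  have h := integral_legendre_sq n
  rw [integral_symm_interval_of_even heven (intervalIntegrable_legendre_pow n 2)] at h
  have hpos : (0 : ℝ) < 2 * n + 1 := by positivity
  field_simp at h ⊢
  linarith

/-- **`‖P_n‖_{L¹[-1,1]} ≤ 2/√(2n+1)`** (Cauchy–Schwarz against `‖P_n‖²_{L²} = 2/(2n+1)`, in the
elementary form `|P| ≤ (r P² + r⁻¹)/2`, `r = √(2n+1)`): the tail input of the Legendre-series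
certificate of plan §6 (`LegendreBound`). [folklore] -/
theorem integral_abs_legendre_le (n : ℕ) :
    ∫ x in (-1 : ℝ)..1, |(legendre n).eval x| ≤ 2 / Real.sqrt (2 * n + 1) := by
  set r : ℝ := Real.sqrt (2 * n + 1) with hr
  have hs : (0 : ℝ) < 2 * n + 1 := by positivity
  have hr0 : 0 < r := Real.sqrt_pos.2 hs
  have hr2 : r ^ 2 = 2 * n + 1 := Real.sq_sqrt hs.le
  have hpt : ∀ x : ℝ, |(legendre n).eval x| ≤ (r ^ 2 * (legendre n).eval x ^ 2 + 1) / (2 * r) := by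
    intro x
    have h := sq_nonneg (r * |(legendre n).eval x| - 1)
    rw [sub_sq, mul_pow, sq_abs] at h
    rw [le_div_iff₀ (by positivity)]
    nlinarith
  have hI : IntervalIntegrable (fun x : ℝ => (r ^ 2 * (legendre n).eval x ^ 2 + 1) / (2 * r))
      volume (-1) 1 :=
    (((intervalIntegrable_legendre_pow n 2 _ _).const_mul _).add
      intervalIntegrable_const).div_const _
  calc ∫ x in (-1 : ℝ)..1, |(legendre n).eval x|
      ≤ ∫ x in (-1 : ℝ)..1, (r ^ 2 * (legendre n).eval x ^ 2 + 1) / (2 * r) :=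
        integral_mono_on (by norm_num)
          ((continuous_abs.comp (legendre n).continuous).intervalIntegrable _ _) hI fun x _ => hpt x
    _ = (r ^ 2 * (2 / (2 * n + 1)) + 2) / (2 * r) := by
        rw [intervalIntegral.integral_div,
          integral_add ((intervalIntegrable_legendre_pow n 2 _ _).const_mul _)
          intervalIntegrable_const, intervalIntegral.integral_const_mul, integral_legendre_sq,
          intervalIntegral.integral_const]
        norm_num
    _ = 2 / r := by
        rw [hr2]
        field_simp
        ring

/-- **`μ_n = 4 ∫₀¹ ρ² |P_n(ρ)| dρ ≤ 4/√(5(2n+1))`** (elementary: `ρ²|P| ≤ (t ρ⁴ + P²/t)/2` with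
`t² = 5/(2n+1)`, `∫₀¹ ρ⁴ = 1/5`, `∫₀¹ P_n² = 1/(2n+1)`): the decay `μ_ℓ = O(ℓ^{-1/2})` used for the
tail `ℓ > 20` of the Legendre-series certificate of plan §6. [folklore] -/
theorem four_mul_integral_sq_mul_abs_legendre_le (n : ℕ) :
    4 * ∫ x in (0 : ℝ)..1, x ^ 2 * |(legendre n).eval x| ≤ 4 / Real.sqrt (5 * (2 * n + 1)) := by
  set r : ℝ := Real.sqrt (2 * n + 1) with hr
  have hs : (0 : ℝ) < 2 * n + 1 := by positivity
  have hr0 : 0 < r := Real.sqrt_pos.2 hs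
  have hr2 : r ^ 2 = 2 * n + 1 := Real.sq_sqrt hs.le
  set q : ℝ := Real.sqrt 5 with hq
  have hq0 : 0 < q := Real.sqrt_pos.2 (by norm_num)
  have hq2 : q ^ 2 = 5 := Real.sq_sqrt (by norm_num)
  have hsqrt : Real.sqrt (5 * (2 * n + 1)) = q * r := by
    rw [hq, hr, ← Real.sqrt_mul (by norm_num)]
  -- `t = q / r`
  have hpt : ∀ x : ℝ, x ^ 2 * |(legendre n).eval x| ≤
      ((q / r) ^ 2 * x ^ 4 + (legendre n).eval x ^ 2) / (2 * (q / r)) := by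
    intro x
    have ht : 0 < q / r := div_pos hq0 hr0
    have h := sq_nonneg (q / r * x ^ 2 - |(legendre n).eval x|)
    rw [sub_sq, mul_pow, sq_abs] at h
    rw [le_div_iff₀ (by positivity)]
    nlinarith [abs_nonneg ((legendre n).eval x)]
  have hI : IntervalIntegrable
      (fun x : ℝ => ((q / r) ^ 2 * x ^ 4 + (legendre n).eval x ^ 2) / (2 * (q / r))) volume 0 1 :=
    ((((continuous_pow 4).intervalIntegrable _ _).const_mul _).add
      (intervalIntegrable_legendre_pow n 2 _ _)).div_const _
  have hJ : IntervalIntegrable (fun x : ℝ => x ^ 2 * |(legendre n).eval x|) volume 0 1 :=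
    ((continuous_pow 2).mul (continuous_abs.comp (legendre n).continuous)).intervalIntegrable _ _
  have key : ∫ x in (0 : ℝ)..1, x ^ 2 * |(legendre n).eval x| ≤ 1 / (q * r) := by
    calc ∫ x in (0 : ℝ)..1, x ^ 2 * |(legendre n).eval x|
        ≤ ∫ x in (0 : ℝ)..1, ((q / r) ^ 2 * x ^ 4 + (legendre n).eval x ^ 2) / (2 * (q / r)) :=
          integral_mono_on zero_le_one hJ hI fun x _ => hpt x
      _ = ((q / r) ^ 2 * (1 / 5) + 1 / (2 * n + 1)) / (2 * (q / r)) := by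
          rw [intervalIntegral.integral_div,
            integral_add (((continuous_pow 4).intervalIntegrable _ _).const_mul _)
              (intervalIntegrable_legendre_pow n 2 _ _), intervalIntegral.integral_const_mul,
            integral_pow,
            integral_legendre_sq_half]
          norm_num
      _ = 1 / (q * r) := by
          rw [← hr2, div_pow, hq2]
          field_simp
          ring
  rw [hsqrt]
  calc 4 * ∫ x in (0 : ℝ)..1, x ^ 2 * |(legendre n).eval x| ≤ 4 * (1 / (q * r)) := by linarith
    _ = 4 / (q * r) := by ring

end Summit.AtomisticToContinuum.HydrodynamicLimit.Theorems.ClampedCorrectorBirth
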